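import Summits.Ventures.CertifiedArithmetic.LowPrec.SRSaturationIntervals
import Summits.Ventures.CertifiedArithmetic.LowPrec.SRSaturationKernel
import HarnessLib

/-!
# Rung R3, saturation without hypotheses: the every-format SR statements as venture Props

HONEST FRAMING: certified error envelopes and provably optimal rounding/accumulation schemes for
low-precision formats under stated cost models; every table by two implementations; no hardware or
vendor claims.

`SRRungR3.lean`, `SRRungR3Trees.lean` and `SRRungR3Order.lean` state the SR summation statements
that hold ABSENT SATURATION (`SR.NoSatT`).  This file states, over the substrate value set
`MiniFloat.valueSet φ` of an ARBITRARY format `φ` and for an ARBITRARY summation tree, the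
generation-4 statements in which that hypothesis is REMOVED (replaced by a certified bound on the
probability of saturation), and inhabits each Prop by a landed theorem (no new mathematics here):

* `R3_SRCouplingIdentity φ` — saturating SR in `φ` and SR in the refinement
  `F' = valueSet φ ∪ {±(maxRat + k·G)}` (uniform grid of the top spacing `G = topGap φ` beyond the
  hull, any depth) generate the SAME probability that some node's pre-rounding sum leaves the hull
  `[−maxRat, maxRat]` (`SRSaturationCoupling.lean`, `SRSaturationFormats.lean`);
* `R3_SRSaturationComparison φ` — for every observable `f` with values in `[0, B]` and every tree,
  `|E_φ f(ŝ_T) − E_{F'} f(ŝ_T)| ≤ B · P(sat)` (`SRSaturationCompare.lean`): every absent-saturation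
  statement about `F'` transfers to the saturating format at the price `P(sat)`;
* `R3_SRSaturationTail φ` — under HEADROOM `h > 0` (every exact partial sum at distance `≥ h` from
  `±maxRat`; a hypothesis on the DATA only), `P(sat) ≤ Σ_nodes 2·exp(−2h²/(m_v·G²))`, `m_v` the
  number of roundings in the subtree (`SRSaturationTail.lean`);
* `R3_SRSaturationAdaptive φ` — the data-adaptive certificate
  `P(sat) ≤ Σ_{v : S_v ≠ 0} 2·exp(−2d_v²/S_v)` with the node's own headroom `d_v` and the interval
  variance proxy `S_v = 4(envI l_v + envI r_v)` computed in `F'` (`SRSaturationIntervals.lean`);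
* `R3_SRNoHypothesisEnvelope φ` — tails, bias and mean square error of SR tree summation in `φ`
  with NO hypothesis on the rounding path: the absent-saturation envelope of `F'` plus the
  saturation term (`SRSaturationFormats.lean`).
* `R3_SRSaturationRational φ` — the adaptive certificate in purely RATIONAL form
  `satBoundIQ` (Euler's `e^{−x} ≤ (1 + x/k)^{−k}`), an inequality between two rationals that the
  kernel evaluates on concrete sums (`SRSaturationKernel.lean`).

Certificates (two independent implementations, byte-identical; `certs/sr/gen4/`): the exact
saturation probability of every leaf tuple of E2M1 for `n = 3, 4, 5` in six tree shapes and of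
E3M2/E2M3 for `n = 3` (`2 882 844` tuples; the coupling identity checked row-wise on the
`1 350 400` rows with `P(sat) > 0`), both certificates against the exact value on every row with
headroom (`0` violations), and the certificates on E3M2/E4M3/E5M2 sums of up to `4096` terms.
-/

namespace Summit.Ventures.CertifiedArithmetic

open Literature.ComputerArithmetic.FloatingPoint
open Literature.ComputerArithmetic.FloatingPoint.MiniFloat
open Summit.Ventures.CertifiedArithmetic.LowPrec
open Real

/-! ### The coupling identity and the comparison of laws -/

/-- R3 (coupling identity, every format, every tree, every refinement depth `N`): the probability
that saturating SR summation in `φ` saturates equals the probability that SR summation in the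
refinement `extendBy (valueSet φ) (−maxRat) maxRat (topGap φ) N` leaves the hull of `φ`.
PROVED (sr seat): `LowPrec.SR.satProbT_eq_exitProb` with `LowPrec.SR.agrees_extendBy` /
`LowPrec.SR.hullData_valueSet`. -/
def R3_SRCouplingIdentity (φ : Format) : Prop :=
  ∀ (T : SR.STree ℚ) (N : ℕ),
    SR.satProbT (valueSet φ) T
      = SR.exitProb (SR.extendBy (valueSet φ) (-φ.maxRat) φ.maxRat (SR.topGap φ) N) (valueSet φ) T

/-- `R3_SRCouplingIdentity`: PROVED for every format. -/
theorem R3_SRCouplingIdentity_holds (φ : Format) : R3_SRCouplingIdentity φ :=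
  fun T N => SR.satProbT_eq_exitProb
    (SR.agrees_extendBy (valueSet φ) (SR.hullData_valueSet φ).gap_pos (SR.hullData_valueSet φ).bounds N) T

/-- R3 (comparison of laws, every format): for every tree, every refinement depth and every
observable `f` with `0 ≤ f ≤ B`, `|E_φ f(ŝ_T) − E_{F'} f(ŝ_T)| ≤ B · P_φ(saturation)`.
PROVED (sr seat): `LowPrec.SR.abs_treeExp_sub_le` (SRSaturationCompare.lean). -/
def R3_SRSaturationComparison (φ : Format) : Prop :=
  ∀ (T : SR.STree ℚ) (N : ℕ) (f : ℚ → ℚ) (B : ℚ), (∀ v, 0 ≤ f v ∧ f v ≤ B) →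
    |SR.treeExp (valueSet φ) T f
        - SR.treeExp (SR.extendBy (valueSet φ) (-φ.maxRat) φ.maxRat (SR.topGap φ) N) T f|
      ≤ B * SR.satProbT (valueSet φ) T

/-- `R3_SRSaturationComparison`: PROVED for every format. -/
theorem R3_SRSaturationComparison_holds (φ : Format) : R3_SRSaturationComparison φ :=
  fun T N _ _ hf => SR.abs_treeExp_sub_le
    (SR.agrees_extendBy (valueSet φ) (SR.hullData_valueSet φ).gap_pos (SR.hullData_valueSet φ).bounds N) T hf

/-! ### The two saturation certificates -/

/-- R3 (uniform saturation certificate, every format, every tree): under headroom `h > 0`,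
`P(sat) ≤ satBoundT (topGap φ) h T = Σ_{internal v} 2·exp(−2h²/(m_v·G²))`.
PROVED (sr seat): `LowPrec.SR.format_satProbT_le` (SRSaturationFormats.lean). -/
def R3_SRSaturationTail (φ : Format) : Prop :=
  ∀ h : ℚ, 0 < h → ∀ T : SR.STree ℚ, SR.HeadroomT (-φ.maxRat) φ.maxRat h T →
    ((SR.satProbT (valueSet φ) T : ℚ) : ℝ) ≤ SR.satBoundT (SR.topGap φ : ℝ) h T

/-- `R3_SRSaturationTail`: PROVED for every format. -/
theorem R3_SRSaturationTail_holds (φ : Format) : R3_SRSaturationTail φ :=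
  fun _ hh T hT => SR.format_satProbT_le φ hh T hT

/-- R3 (adaptive saturation certificate, every format, every tree): under headroom `h > 0`,
`P(sat) ≤ satBoundI F' (−maxRat) maxRat T = Σ_{v : S_v ≠ 0} 2·exp(−2d_v²/S_v)` with
`d_v = min(s_v + maxRat, maxRat − s_v)` and `S_v = 4(envI F' l_v + envI F' r_v)` the interval
variance proxy computed in the refinement `F'` of depth `m − 1`.
PROVED (sr seat): `LowPrec.SR.format_satProbT_le_I` (SRSaturationIntervals.lean). -/
def R3_SRSaturationAdaptive (φ : Format) : Prop :=
  ∀ h : ℚ, 0 < h → ∀ T : SR.STree ℚ, SR.HeadroomT (-φ.maxRat) φ.maxRat h T →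
    ((SR.satProbT (valueSet φ) T : ℚ) : ℝ)
      ≤ SR.satBoundI (SR.extendBy (valueSet φ) (-φ.maxRat) φ.maxRat (SR.topGap φ) (T.nodes - 1))
          (-φ.maxRat) φ.maxRat T

/-- `R3_SRSaturationAdaptive`: PROVED for every format. -/
theorem R3_SRSaturationAdaptive_holds (φ : Format) : R3_SRSaturationAdaptive φ :=
  fun _ hh T hT => SR.format_satProbT_le_I φ hh T hT

/-! ### Tails, bias and mean square error with no hypothesis on the rounding path -/

/-- R3 (no-hypothesis envelope, every format, every tree): under headroom `h > 0` only,
(i) `P(|ŝ_T − Σ| ≥ t) ≤ 2·exp(−2t²/(m·G²)) + satBoundT G h T` for every `t > 0`,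
(ii) `|E ŝ_T − Σ| ≤ 2R · satBoundT G h T` and (iii) `E(ŝ_T − Σ)² ≤ m·G²/4 + R² · satBoundT G h T`,
with `G = topGap φ`, `m = T.nodes` and `R = max(2·maxRat, m·G)`.
PROVED (sr seat): `LowPrec.SR.format_prob_dev_ge_le`, `format_abs_treeBias_le`, `format_sq_err_le`
(SRSaturationFormats.lean). -/
def R3_SRNoHypothesisEnvelope (φ : Format) : Prop :=
  ∀ h : ℚ, 0 < h → ∀ T : SR.STree ℚ, SR.HeadroomT (-φ.maxRat) φ.maxRat h T →
    (∀ t : ℚ, 0 < t →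
        ((SR.treeExp (valueSet φ) T (SR.devInd t T.exact) : ℚ) : ℝ)
          ≤ 2 * exp (-2 * (t : ℝ) ^ 2 / (T.nodes * (SR.topGap φ : ℝ) ^ 2))
            + SR.satBoundT (SR.topGap φ : ℝ) h T)
    ∧ ((|SR.treeBias (valueSet φ) T| : ℚ) : ℝ)
        ≤ 2 * ((max (φ.maxRat - -φ.maxRat) (T.nodes * SR.topGap φ) : ℚ) : ℝ)
            * SR.satBoundT (SR.topGap φ : ℝ) h T
    ∧ ((SR.treeExp (valueSet φ) T (fun v => (v - T.exact) ^ 2) : ℚ) : ℝ)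
        ≤ T.nodes * (SR.topGap φ : ℝ) ^ 2 / 4
            + ((max (φ.maxRat - -φ.maxRat) (T.nodes * SR.topGap φ) : ℚ) : ℝ) ^ 2
                * SR.satBoundT (SR.topGap φ : ℝ) h T

/-- `R3_SRNoHypothesisEnvelope`: PROVED for every format. -/
theorem R3_SRNoHypothesisEnvelope_holds (φ : Format) : R3_SRNoHypothesisEnvelope φ :=
  fun _ hh T hT =>
    ⟨fun t ht => SR.format_prob_dev_ge_le φ hh T hT t ht, SR.format_abs_treeBias_le φ hh T hT,
      SR.format_sq_err_le φ hh T hT⟩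

/-! ### The rational certificate -/

/-- R3 (rational saturation certificate, every format, every tree, every Euler parameter `k`):
under headroom `h > 0` only, `P(saturation) ≤ satBoundIQ F' (−maxRat) maxRat k T`, where
`satBoundIQ = Σ_{v : S_v ≠ 0} 2·(1 + x_v/k)^{−k}`, `x_v = 2d_v²/S_v` — both sides RATIONAL, the right
side a closed term the kernel evaluates (`SRSaturationKernel.lean`, section `Kernel`: E4M3,
balanced, `n = 64`, `P(sat) ≤ 10⁻³⁸` as one theorem).
PROVED (sr seat): `LowPrec.SR.format_satProbT_le_IQ`. -/
def R3_SRSaturationRational (φ : Format) : Prop :=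
  ∀ h : ℚ, 0 < h → ∀ T : SR.STree ℚ, SR.HeadroomT (-φ.maxRat) φ.maxRat h T → ∀ k : ℕ,
    SR.satProbT (valueSet φ) T
      ≤ SR.satBoundIQ (SR.extendBy (valueSet φ) (-φ.maxRat) φ.maxRat (SR.topGap φ) (T.nodes - 1))
          (-φ.maxRat) φ.maxRat k T

/-- `R3_SRSaturationRational`: PROVED for every format. -/
theorem R3_SRSaturationRational_holds (φ : Format) : R3_SRSaturationRational φ :=
  fun _ hh T hT k => SR.format_satProbT_le_IQ φ hh T hT k

end Summit.Ventures.CertifiedArithmetic
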